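import Literature.Claims.NS.Zhong2026
import Literature.Analysis.FluidPDE.VorticityDirectionDynamics
import Literature.Analysis.FluidPDE.VorticityEquation
import Literature.Analysis.FluidPDE.BKMClassVorticityTimeLipschitz
import Mathlib.Analysis.SpecialFunctions.Log.Deriv
import HarnessLib

/-!
# Solo salvage for claim C161 `Zhong2026` (cell `ns-claims`, D-0090), part 2: the logarithmic-vorticity
# transport identity (17) and Lemma 3.1

Claim C161: skeleton `Literature.Claims.NS.Zhong2026` (typist-9 g5; ADJUDICATED #144, first failing step
`Step_exhaustive`, class false lemma — untouched here). Records-grade TRUE-column / downstream facts, salvage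
seat `ns-claims-salvage-p1` g4 (solo lane; no statement item):

* `step_L31_holds` — **Lemma 3.1 p.4 l.42–55 (`Step_L31`) HOLDS** as typed: a class field (`Chae2007.IsDatum`,
  all Sobolev norms finite) has bounded vorticity; the vorticity maximum is even attained
  (`Zhong2026.exists_forall_norm_curl_le`, typist-1 g5 rev 4). The extra hypotheses of the lemma are not used.
* `matDpsi_eq` — **the CORRECT form of display (17) p.5 l.72–82**: along a class solution, at an interior time
  and a point where `ω ≠ 0`, the material derivative of `ψ = ln|ω|` is
  `Dψ/Dt = S₀ + ν Δe^ψ/e^ψ − ν|∇ω̂|²`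
  (Galanti–Gibbon–Heritage 1997 §3 (Dw1)+(Dw4), the tree's
  `VorticityDirectionDynamics.NavierStokes.hasDerivAt_norm_curl`: `(∂ₜ + u·∇ − νΔ)|ω| = α|ω| − ν|ω||∇ξ|²`,
  divided by `|ω|`). The PRINTED (17), typed verbatim as `Step_17`, reads
  `Dψ/Dt = S₀ + ν Δe^ψ/e^ψ − ν|∇ψ|² − ν|∇ω̂|²` — it carries an extra term `−ν|∇ψ|²`.
* `printed17_iff_gpsi_eq_zero` — hence, at such a point, the printed display holds IFF `∇ψ = 0` there;
* `step_17_iff_frame_empty` — and `Step_17` (the display asserted at every point of every interior slice with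
  `ω ≠ 0` everywhere) holds IFF no class solution has an interior vorticity slice that vanishes nowhere: given
  such a slice, (17) would force `∇ψ ≡ 0`, i.e. `|ω|` constant and positive on `ℝ³`, against the decay of an
  `H^∞` slice (`Zhong2026.exists_norm_curl_lt`). So `Step_17`, flagged TRUE-type in the skeleton, is NOT the
  transport identity: it is true exactly in the vacuous regime of its own standing hypothesis «ω ≠ 0
  everywhere» (p.4 l.17) — the hypothesis whose failure on the Clay class is the located head
  `Step_exhaustive`. Whether that regime is empty is not decided here (no kernel witness either way).

Nothing here touches the VERDICT of record (head `Step_exhaustive`, class false lemma, by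
`…Theorems.Zhong2026.not_Step_exhaustive` p532743); these are records for the TRUE / not-reusable columns.

WHAT THIS IS NOT: not a claim about NS regularity or blow-up; not a claim about any author beyond the typed
locator.
-/

set_option linter.dupNamespace false

noncomputable section

open Set Filter MeasureTheory Topology InnerProductSpace
open scoped RealInnerProductSpace Laplacian ContDiff ENNReal

namespace Summit.NavierStokesRegularity.NavierStokesRegularity.Theorems.Zhong2026Salvage

open Literature.Analysis.FluidPDE Literature.Claims.NS.Zhong2026
open Literature.Claims.NS.Chae2007 (IsLocalSolution IsDatum)

/-! ## Lemma 3.1 (`Step_L31`) -/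

/-- **`Step_L31` (Lemma 3.1 p.4 l.42–55) holds**: an `IsDatum` field has bounded vorticity — the vorticity
maximum of an `H^∞` field with `ω ≢ 0` is attained (`exists_forall_norm_curl_le`); the functional hypotheses
(`IsFMaxAt`, `f = 0`) are not needed. [cite: Zhong2026, Lemma 3.1 p.4 l.42–55] -/
theorem step_L31_holds : Step_L31 := by
  intro ν _ v hv hnv x₀ _ _
  obtain ⟨xs, hxs⟩ := exists_forall_norm_curl_le hv.1 hv.2.2 (hnv x₀)
  exact ⟨‖curl v xs‖, hxs⟩

/-! ## Slices of class solutions -/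

variable {ν T : ℝ} {v₀ : E3 → E3} {u : ℝ → E3 → E3} {p : ℝ → E3 → ℝ} {t : ℝ}

/-- Slices of a class solution are smooth. [folklore] -/
theorem contDiff_slice (hsol : IsLocalSolution ν T v₀ u p) (ht : t ∈ Ico 0 T) : ContDiff ℝ ∞ (u t) :=
  hsol.isClassical.contDiff_velocity ht

/-- Slices of a class solution have all `L²` Sobolev seminorms finite (`IsLocalSolution.sobolev` on `[0,t]`).
[folklore] -/
theorem sobolev_slice (hsol : IsLocalSolution ν T v₀ u p) (ht : t ∈ Ico 0 T) (n : ℕ) :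
    ∫⁻ x, ‖iteratedFDeriv ℝ n (u t) x‖ₑ ^ 2 < ⊤ := by
  obtain ⟨C, hC⟩ := hsol.sobolev t ht.2 n
  exact (hC t ⟨ht.1, le_rfl⟩).trans_lt ENNReal.coe_lt_top

/-- **The pointwise vorticity equation at interior times**, as a two-sided time derivative:
`∂ₜω = νΔω − (u·∇)ω + (ω·∇)u` at `(t,x)`, `t ∈ (0,T)` (the tree's `IsClassicalNSSolutionOn.vorticity_eq`
on `[0,T)` plus `∂ₜ curl = curl ∂ₜ`, `IsSmoothSpaceTimeOn.hasDerivWithinAt_curl_slice`).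
[cite: Zhong2026, (2) p.1 l.31–35 (vorticity equation)] -/
theorem hasDerivAt_curl (hsol : IsLocalSolution ν T v₀ u p) (ht : t ∈ Ioo 0 T) (x : E3) :
    HasDerivAt (fun s => curl (u s) x)
      (ν • (Δ (curl (u t))) x - convect (u t) (curl (u t)) x + convect (curl (u t)) (u t) x) t := by
  have hT : (0 : ℝ) < T := ht.1.trans ht.2
  have hS : UniqueDiffOn ℝ (Ico (0 : ℝ) T) := uniqueDiffOn_Ico 0 T
  have hcl : Ico (0 : ℝ) T ⊆ closure (interior (Ico (0 : ℝ) T)) := by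
    rw [interior_Ico, closure_Ioo hT.ne]
    exact Ico_subset_Icc_self
  have htS : t ∈ Ico (0 : ℝ) T := ⟨ht.1.le, ht.2⟩
  have hcurl : ∀ s ∈ Ico (0 : ℝ) T, ∀ y : E3, curl ((0 : ℝ → E3 → E3) s) y = 0 :=
    fun s _ y => curl_zero y
  have heq := hsol.isClassical.vorticity_eq hS hcl hcurl htS x
  have hd : HasDerivWithinAt (fun s => curl (u s) x) (curl (timeDerivWithin (Ico 0 T) u t) x)
      (Ico 0 T) t :=
    hsol.isClassical.smooth_velocity.hasDerivWithinAt_curl_slice hS hcl htS x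
  have h1 : timeDerivWithin (Ico 0 T) (vorticity u) t x = curl (timeDerivWithin (Ico 0 T) u t) x := by
    have h2 : HasDerivWithinAt (fun s => vorticity u s x) (curl (timeDerivWithin (Ico 0 T) u t) x)
        (Ico 0 T) t := by
      simpa only [vorticity_apply] using hd
    exact h2.derivWithin (hS t htS)
  rw [h1, vorticity_apply] at heq
  have hval : curl (timeDerivWithin (Ico 0 T) u t) x =
      ν • (Δ (curl (u t))) x - convect (u t) (curl (u t)) x + convect (curl (u t)) (u t) x := by
    calc curl (timeDerivWithin (Ico 0 T) u t) x
        = (curl (timeDerivWithin (Ico 0 T) u t) x + convect (u t) (curl (u t)) x) -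
            convect (u t) (curl (u t)) x := by abel
      _ = (convect (curl (u t)) (u t) x + ν • (Δ (curl (u t))) x) - convect (u t) (curl (u t)) x := by
            rw [heq]
      _ = _ := by abel
  exact (hd.hasDerivAt (Ico_mem_nhds ht.1 ht.2)).congr_deriv hval

/-! ## The logarithmic-vorticity transport identity: the correct (17) -/

/-- `⟪v, ∇ψ(x)⟫ = D|ω|(x)(v)/|ω(x)|` for `ψ = ln|ω|`, `ω(x) ≠ 0` (chain rule; `gpsi` is Mathlib's gradient).
[cite: Zhong2026, (10)–(11) p.4 l.17–33] -/
theorem inner_gpsi_eq {w : E3 → E3} (hw : ContDiff ℝ 1 w) {x : E3} (hx : w x ≠ 0) (v : E3) :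
    ⟪v, gpsi w x⟫ = ‖w x‖⁻¹ * fderiv ℝ (fun y => ‖w y‖) x v := by
  have hdn : DifferentiableAt ℝ (fun y => ‖w y‖) x :=
    ((hw.differentiable one_ne_zero).differentiableAt).norm ℝ hx
  have hfd : fderiv ℝ (psi w) x = (‖w x‖)⁻¹ • fderiv ℝ (fun y => ‖w y‖) x := by
    show fderiv ℝ (fun y => Real.log ‖w y‖) x = _
    exact fderiv.log hdn (norm_ne_zero_iff.2 hx)
  unfold gpsi
  rw [real_inner_comm, gradient, InnerProductSpace.toDual_symm_apply, hfd]
  rfl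

/-- The stretching rate `α = ⟪ξ, ∇u ξ⟫` of the tree equals the print's `S₀ = ω̂·∇v·ω̂` (4) p.3.
[cite: Zhong2026, (4) p.3 l.14–17] -/
theorem alpha_eq_S0 (v : E3 → E3) {x : E3} (hx : curl v x ≠ 0) :
    ⟪vorticityDirection (curl v) x, fderiv ℝ v x (vorticityDirection (curl v) x)⟫ = S0 v x := by
  unfold S0
  rw [vorticityDirection_apply, map_smul, real_inner_smul_left, real_inner_smul_right]
  have hρ : ‖curl v x‖ ≠ 0 := norm_ne_zero_iff.2 hx
  field_simp

/-- **The CORRECT display (17)** (Galanti–Gibbon–Heritage 1997 §3; the print's (17) p.5 l.72–82 WITHOUT its term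
`−ν|∇ψ|²`): along a class solution on `[0,T)`, at `t ∈ (0,T)` and a point with `ω(t,x) ≠ 0`,
`Dψ/Dt = S₀ + ν Δe^ψ/e^ψ − ν|∇ω̂|²` in the skeleton's vocabulary (`matDpsi`, `S0`, `lapRatio`, `gradDirSq`).
Any `ν : ℝ`. [cite: Zhong2026, (17) p.5 l.72–82] [cite: GalantiGibbonHeritage1997, §3 (Dw1), (Dw4)] -/
theorem matDpsi_eq (hsol : IsLocalSolution ν T v₀ u p) (ht : t ∈ Ioo 0 T) {x : E3}
    (hx : curl (u t) x ≠ 0) :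
    matDpsi u t x = S0 (u t) x + ν * lapRatio (curl (u t)) x - ν * gradDirSq (curl (u t)) x := by
  have htS : t ∈ Ico (0 : ℝ) T := ⟨ht.1.le, ht.2⟩
  have hsm : ContDiff ℝ ∞ (u t) := contDiff_slice hsol htS
  have hω2 : ContDiff ℝ 2 (curl (u t)) := contDiff_curl (n := 2) (hsm.of_le (by norm_cast))
  have hω1 : ContDiff ℝ 1 (curl (u t)) := contDiff_curl (n := 1) (hsm.of_le (by norm_cast))
  have hρ : ‖curl (u t) x‖ ≠ 0 := norm_ne_zero_iff.2 hx
  -- magnitude equation (GGH97 (Dw1)+(Dw4)) at `(t,x)`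
  have hD := VorticityDirectionDynamics.NavierStokes.hasDerivAt_norm_curl hω2.contDiffAt hx
    (hasDerivAt_curl hsol ht x)
  -- `∂ₜψ`
  have hψ : HasDerivAt (fun s => psi (curl (u s)) x) (_ / ‖curl (u t) x‖) t := hD.log hρ
  unfold matDpsi
  rw [hψ.deriv, inner_gpsi_eq hω1 hx, alpha_eq_S0 (u t) hx]
  unfold lapRatio gradDirSq
  rw [show dirField (curl (u t)) = vorticityDirection (curl (u t)) from rfl]
  field_simp
  ring

/-- **The printed (17) at a point ⇔ `∇ψ = 0` there** (`ν ≠ 0`): the display carries the spurious `−ν|∇ψ|²`.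
[cite: Zhong2026, (17) p.5 l.72–82] -/
theorem printed17_iff_gpsi_eq_zero (hsol : IsLocalSolution ν T v₀ u p) (hν : ν ≠ 0) (ht : t ∈ Ioo 0 T)
    {x : E3} (hx : curl (u t) x ≠ 0) :
    matDpsi u t x = S0 (u t) x + ν * lapRatio (curl (u t)) x - ν * ‖gpsi (curl (u t)) x‖ ^ 2 -
        ν * gradDirSq (curl (u t)) x ↔ gpsi (curl (u t)) x = 0 := by
  rw [matDpsi_eq hsol ht hx]
  constructor
  · intro h
    have h2 : ν * ‖gpsi (curl (u t)) x‖ ^ 2 = 0 := by linarith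
    rcases mul_eq_zero.1 h2 with h3 | h3
    · exact absurd h3 hν
    · exact norm_eq_zero.1 ((pow_eq_zero_iff two_ne_zero).1 h3)
  · intro h
    rw [h, norm_zero]
    ring

/-- If `∇ψ ≡ 0` for a `C¹` nowhere-vanishing field then `|ω|` is constant (`ψ = ln|ω|` has zero derivative on the
connected space `ℝ³`). [folklore] -/
theorem norm_eq_norm_of_gpsi_eq_zero {w : E3 → E3} (hw : ContDiff ℝ 1 w) (hnv : NonVanishing w)
    (hg : ∀ x, gpsi w x = 0) (x y : E3) : ‖w x‖ = ‖w y‖ := by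
  have hdiff : Differentiable ℝ (psi w) := fun z => by
    show DifferentiableAt ℝ (fun y => Real.log ‖w y‖) z
    exact (((hw.differentiable one_ne_zero).differentiableAt).norm ℝ (hnv z)).log
      (norm_ne_zero_iff.2 (hnv z))
  have hfd : ∀ z, fderiv ℝ (psi w) z = 0 := fun z => by
    have h := hg z
    unfold gpsi gradient at h
    simpa using h
  have hc : psi w x = psi w y := is_const_of_fderiv_eq_zero hdiff hfd x y
  exact Real.log_injOn_pos (mem_Ioi.2 (norm_pos_iff.2 (hnv x))) (mem_Ioi.2 (norm_pos_iff.2 (hnv y))) hc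

/-- **`Step_17` ⇔ its own frame is empty.** The printed (17), asserted at every point of every interior
vorticity slice that vanishes nowhere, holds IFF no class solution (`ν > 0`) has such a slice: on a slice with
`ω ≠ 0` everywhere the printed display forces `∇ψ ≡ 0` (`printed17_iff_gpsi_eq_zero`), so `|ω|` is a positive
constant (`norm_eq_norm_of_gpsi_eq_zero`), contradicting the decay of `H^∞` slices (`exists_norm_curl_lt`);
conversely an empty frame makes `Step_17` vacuous. [cite: Zhong2026, (17) p.5 l.72–82; §3.1 p.4 l.17] -/
theorem step_17_iff_frame_empty : Step_17 ↔
    ∀ ν : ℝ, 0 < ν → ∀ (T : ℝ) (v₀ : E3 → E3) (u : ℝ → E3 → E3) (p : ℝ → E3 → ℝ),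
      IsLocalSolution ν T v₀ u p → ∀ t ∈ Ioo 0 T, ¬ NonVanishing (curl (u t)) := by
  constructor
  · intro h17 ν hν T v₀ u p hsol t ht hnv
    have htS : t ∈ Ico (0 : ℝ) T := ⟨ht.1.le, ht.2⟩
    have hsm : ContDiff ℝ ∞ (u t) := contDiff_slice hsol htS
    have hg : ∀ x, gpsi (curl (u t)) x = 0 := fun x =>
      (printed17_iff_gpsi_eq_zero hsol hν.ne' ht (hnv x)).1 (h17 ν hν T v₀ u p hsol t ht hnv x)
    have hw1 : ContDiff ℝ 1 (curl (u t)) := contDiff_curl (n := 1) (hsm.of_le (by norm_cast))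
    have hconst := norm_eq_norm_of_gpsi_eq_zero hw1 hnv hg
    obtain ⟨R, hR⟩ := exists_norm_curl_lt hsm (sobolev_slice hsol htS) (norm_pos_iff.2 (hnv 0))
    have hz : 0 < ‖curl (u t) 0‖ := norm_pos_iff.2 (hnv 0)
    set y : E3 := ((|R| + 1) / ‖curl (u t) 0‖) • curl (u t) 0 with hy
    have hyn : R < ‖y‖ := by
      rw [hy, norm_smul, Real.norm_eq_abs, abs_of_pos (by positivity), div_mul_cancel₀ _ hz.ne']
      linarith [le_abs_self R]
    have hlt := hR y hyn
    rw [hconst y 0] at hlt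
    exact lt_irrefl _ hlt
  · intro h ν hν T v₀ u p hsol t ht hnv x
    exact absurd hnv (h ν hν T v₀ u p hsol t ht)

end Summit.NavierStokesRegularity.NavierStokesRegularity.Theorems.Zhong2026Salvage

end
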